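import Literature.Geometry.Kaehler.HolomorphicChainBlowUp
import Literature.Geometry.GeometricMeasureTheory.DilateFlatEstimate
import HarnessLib

/-!
# Consecutive blow-ups of a holomorphic chain: flat distance bounded by the conical defect

The quantitative core of the tangent-cone problem for the currents
`D_r = (1/r)_*(τ_{-b})_*[T]` (`HolomorphicChain.blowUp`) of a holomorphic chain: for
`0 < s ≤ 1` the dilate `μ_{s#} D_r` IS `D_{r/s}` on forms supported in `B(0,s)`
(`HolomorphicChain.dilate_blowUp_apply`), so the Euler homotopy formula with its conical-defect
estimate (`Literature/Geometry/GeometricMeasureTheory/DilateFlatEstimate.lean`, after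
[Federer1969, 4.1.9]) gives

`|D_r(ψ) − D_{r/s}(ψ)| ≤ (1 − s) · sup ‖dψ‖ · ∫_{W_r} |θ_T(b + r y)| ‖y − z(y)‖ d𝓗^{2p}(y)`

(`HolomorphicChain.abs_blowUp_sub_apply_le`) for every test form `ψ` supported in `B(0,s)` and
every measurable choice `z(y)` in the tangent `2p`-plane `span ξ_T(b + r y)` (with `z` the
orthogonal projection the integral is the conical defect `∫ |θ| |y^⊥| d‖D_r‖`), provided `D_r` is a
cycle of finite mass with admissible data — which the named facts
`Harvey1977_isRectifiableData_toCurrent`, `Harvey1977_boundary_toCurrent_eq_zero` (and Lelong's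
theorem for the finiteness) supply. Decay of the defect as `r → 0` summed over the scales
`r, r/s, r/s², …` is what makes `(D_r)` Cauchy in `𝓕^{loc}(B(0,1))` [Federer1969, 4.3.16–4.3.18];
[Harvey1977, Thm. 1.31].

No definitions, no named facts.

## References

* H. Federer, *Geometric Measure Theory*, Springer 1969, 4.1.9, 4.3.16 [Federer1969].
* R. Harvey, *Holomorphic chains and their boundaries*, PSPUM XXX.1 (1977), §1.10, Thm. 1.31
  [Harvey1977].
-/

open scoped Manifold ContDiff Topology ENNReal Pointwise Distributions
open Set Filter MeasureTheory

namespace Literature.Geometry.Kaehler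

open Literature.Geometry.GeometricMeasureTheory

-- Nested operator-norm instances on `Covector V m`, as in `Currents.lean`.
set_option maxSynthPendingDepth 2

universe u

variable {V : Type*} [NormedAddCommGroup V] [InnerProductSpace ℂ V]
  [MeasurableSpace V] [BorelSpace V] {Ω : TopologicalSpace.Opens V} {p : ℕ}

/-- **`μ_{s#} D_r = D_{r/s}` on forms supported in `B(0,s)`**: dilating the data of the blow-up at
scale `r` by `s⁻¹` (as in `DilateFlatEstimate.lean`) gives the data of the blow-up at scale `r/s`
restricted to `B(0,s)`, so the two currents agree on every test form supported in `B(0,s)`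
(admissible data, `0 < r`, `0 < s ≤ 1`, `B(b, r/s) ⊆ Ω`). [cite: Federer1969, 4.3.16] -/
theorem HolomorphicChain.dilate_blowUp_apply (T : HolomorphicChain 𝓘(ℂ, V) Ω p)
    (hT : letI : InnerProductSpace ℝ V := InnerProductSpace.complexToReal
      IsRectifiableData Ω (2 * p) T.carrier T.density T.orientationFrame)
    {b : V} {r s : ℝ} (hr : 0 < r) (hs0 : 0 < s) (hs1 : s ≤ 1)
    (hball : Metric.ball b (r / s) ⊆ (Ω : Set V)) (ψ : TestForm (unitBall V) (2 * p))
    (hψs : tsupport ⇑ψ ⊆ Metric.ball (0 : V) s) :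
    (currentOfIntegration
        ((fun y : V => (0 : V) + s⁻¹ • y) ⁻¹'
            ((fun y : V => b + r • y) ⁻¹' T.carrier ∩ Metric.ball (0 : V) 1) ∩ Metric.ball (0 : V) s)
        (fun y => T.density (b + r • ((0 : V) + s⁻¹ • y)))
        (fun y => T.orientationFrame (b + r • ((0 : V) + s⁻¹ • y))) :
        Current (unitBall V) (2 * p)) ψ =
      T.blowUp b (r / s) ψ := by
  letI : InnerProductSpace ℝ V := InnerProductSpace.complexToReal
  have hrs : 0 < r / s := div_pos hr hs0
  have hball' : Metric.ball b r ⊆ (Ω : Set V) :=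
    (Metric.ball_subset_ball (by rw [le_div_iff₀ hs0]; nlinarith)).trans hball
  -- the dilated data ARE the data at scale `r / s`
  have hpt : ∀ y : V, b + r • ((0 : V) + s⁻¹ • y) = b + (r / s) • y := fun y => by
    rw [zero_add, smul_smul, div_eq_mul_inv]
  have hθ : (fun y => T.density (b + r • ((0 : V) + s⁻¹ • y))) =
      fun y => T.density (b + (r / s) • y) := funext fun y => by rw [hpt]
  have hξ : (fun y => T.orientationFrame (b + r • ((0 : V) + s⁻¹ • y))) =
      fun y => T.orientationFrame (b + (r / s) • y) := funext fun y => by rw [hpt]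
  have hset : (fun y : V => (0 : V) + s⁻¹ • y) ⁻¹'
      ((fun y : V => b + r • y) ⁻¹' T.carrier ∩ Metric.ball (0 : V) 1) ∩ Metric.ball (0 : V) s =
      ((fun y : V => b + (r / s) • y) ⁻¹' T.carrier ∩ Metric.ball (0 : V) 1) ∩ Metric.ball (0 : V) s := by
    ext y
    simp only [mem_inter_iff, mem_preimage, hpt, mem_ball_zero_iff]
    constructor
    · rintro ⟨⟨h1, -⟩, h3⟩
      exact ⟨⟨h1, h3.trans_le hs1⟩, h3⟩
    · rintro ⟨⟨h1, -⟩, h3⟩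
      refine ⟨⟨h1, ?_⟩, h3⟩
      rw [zero_add, norm_smul, norm_inv, Real.norm_of_nonneg hs0.le, inv_mul_lt_iff₀ hs0]
      linarith
  rw [hθ, hξ, hset, HolomorphicChain.blowUp]
  -- data at scale `r / s`: admissible on `B(0,1)`
  obtain ⟨hmeas, -, -, hint, -⟩ := T.isRectifiableData_blowUp hT hrs hball
  have hint' : LocallyIntegrableOn
      (fun y => ((T.density (b + (r / s) • y) : ℤ) : ℝ) •
        frameVector (T.orientationFrame (b + (r / s) • y))) (unitBall V : Set V)
      ((μHE[2 * p] : Measure V).restrict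
        (((fun y : V => b + (r / s) • y) ⁻¹' T.carrier ∩ Metric.ball (0 : V) 1) ∩
          Metric.ball (0 : V) s)) := by
    intro y hy
    obtain ⟨u, hu, hu'⟩ := hint y hy
    exact ⟨u, hu, hu'.mono_measure (Measure.restrict_mono Set.inter_subset_left le_rfl)⟩
  exact currentOfIntegration_apply_eq_of_inter_eq (hmeas.inter Metric.isOpen_ball.measurableSet)
    hmeas hint' hint (U := Metric.ball (0 : V) s)
    (by rw [Set.inter_assoc, Set.inter_self]) ψ hψs

/-- **Flat distance between consecutive blow-ups ≤ conical defect.** Let `T` be a holomorphic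
`(q+1)`-chain with admissible data and `∂[T] = 0` on `Ω`, `0 < r`, `0 < s ≤ 1`, `B(b, r/s) ⊆ Ω`,
and suppose the blow-up `D_r` has finite mass: `𝓗^{2q+2}(W_r) < ∞` and `θ_r ξ_r` summable on the
carrier `W_r = {y : b + r y ∈ reg |T|} ∩ B(0,1)` (Lelong). Then for every test form `ψ` on `B(0,1)`
supported in `B(0,s)` with `‖dψ‖ ≤ M`, and every measurable choice `z(y) ∈ span ξ_T(b + r y)`
(a.e. on `W_r`) with `|θ_r| ‖y − z(y)‖` summable:
`|D_r(ψ) − D_{r/s}(ψ)| ≤ (1 − s) · M · ∫_{W_r} |θ_T(b + r y)| ‖y − z(y)‖ d𝓗^{2q+2}(y)`.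
[cite: Federer1969, 4.1.9] -/
theorem HolomorphicChain.abs_blowUp_sub_apply_le [FiniteDimensional ℂ V] {q : ℕ}
    (T : HolomorphicChain 𝓘(ℂ, V) Ω (q + 1))
    (hT : letI : InnerProductSpace ℝ V := InnerProductSpace.complexToReal
      IsRectifiableData Ω (2 * (q + 1)) T.carrier T.density T.orientationFrame)
    (h0 : T.boundary = 0) {b : V} {r s : ℝ} (hr : 0 < r) (hs0 : 0 < s) (hs1 : s ≤ 1)
    (hball : Metric.ball b (r / s) ⊆ (Ω : Set V))
    (hfin : (μHE[2 * q + 1 + 1] : Measure V)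
      ((fun y : V => b + r • y) ⁻¹' T.carrier ∩ Metric.ball (0 : V) 1) ≠ (⊤ : ℝ≥0∞))
    (hint : letI : InnerProductSpace ℝ V := InnerProductSpace.complexToReal
      Integrable (fun y => ((T.density (b + r • y) : ℤ) : ℝ) •
        frameVector (T.orientationFrame (b + r • y)))
        ((μHE[2 * q + 1 + 1] : Measure V).restrict
          ((fun y : V => b + r • y) ⁻¹' T.carrier ∩ Metric.ball (0 : V) 1)))
    {z : V → V}
    (hz : ∀ᵐ y ∂((μHE[2 * q + 1 + 1] : Measure V).restrict
        ((fun y : V => b + r • y) ⁻¹' T.carrier ∩ Metric.ball (0 : V) 1)),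
      z y ∈ Submodule.span ℝ (Set.range (T.orientationFrame (b + r • y))))
    (hθz : Integrable (fun y => |((T.density (b + r • y) : ℤ) : ℝ)| * ‖y - z y‖)
      ((μHE[2 * q + 1 + 1] : Measure V).restrict
        ((fun y : V => b + r • y) ⁻¹' T.carrier ∩ Metric.ball (0 : V) 1)))
    (ψ : TestForm (unitBall V) (2 * q + 1 + 1)) (hψs : tsupport ⇑ψ ⊆ Metric.ball (0 : V) s)
    {M : ℝ} (hM : ∀ x, ‖extDeriv ⇑ψ x‖ ≤ M) :
    |(T.blowUp b r : Current (unitBall V) (2 * q + 1 + 1)) ψ -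
        (T.blowUp b (r / s) : Current (unitBall V) (2 * q + 1 + 1)) ψ| ≤
      (1 - s) * M * ∫ y in (fun y : V => b + r • y) ⁻¹' T.carrier ∩ Metric.ball (0 : V) 1,
        |((T.density (b + r • y) : ℤ) : ℝ)| * ‖y - z y‖ ∂(μHE[2 * q + 1 + 1] : Measure V) := by
  letI : InnerProductSpace ℝ V := InnerProductSpace.complexToReal
  have hball' : Metric.ball b r ⊆ (Ω : Set V) :=
    (Metric.ball_subset_ball (by rw [le_div_iff₀ hs0]; nlinarith)).trans hball
  obtain ⟨hmeasW, -, -, -, hae⟩ := T.isRectifiableData_blowUp hT hr hball'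
  have hcycle := T.boundary_blowUp_eq_zero hT h0 hr hball'
  have hξ' : ∀ᵐ y ∂((μHE[2 * q + 1 + 1] : Measure V).restrict
      ((fun y : V => b + r • y) ⁻¹' T.carrier ∩ Metric.ball (0 : V) 1)),
      Orthonormal ℝ (T.orientationFrame (b + r • y)) ∧
        z y ∈ Submodule.span ℝ (Set.range (T.orientationFrame (b + r • y))) := by
    filter_upwards [hae, hz] with y h1 h2
    exact ⟨h1.1, h2⟩
  have hdil := T.dilate_blowUp_apply hT hr hs0 hs1 hball ψ hψs
  have key := abs_sub_dilate_apply_le (V := V) (B := unitBall V) (k := 2 * q + 1) rfl hmeasW hfin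
    (fun y => T.density (b + r • y)) (fun y => T.orientationFrame (b + r • y)) hint hξ' hθz
    hcycle hs0 hs1 ψ hψs hM
  rw [hdil] at key
  exact key

/-- `HolomorphicChain.abs_blowUp_sub_apply_le` under the named facts
`Harvey1977_isRectifiableData_toCurrent` and `Harvey1977_boundary_toCurrent_eq_zero` (the
finite-mass hypotheses on `D_r`, consequences of Lelong's theorem, are kept explicit).
[cite: Harvey1977, Thm. 1.31] -/
theorem HolomorphicChain.abs_blowUp_sub_apply_le' (h : Harvey1977_isRectifiableData_toCurrent.{u})
    (h' : Harvey1977_boundary_toCurrent_eq_zero.{u})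
    {V : Type u} [NormedAddCommGroup V] [InnerProductSpace ℂ V] [FiniteDimensional ℂ V]
    [MeasurableSpace V] [BorelSpace V] {Ω : TopologicalSpace.Opens V} {q : ℕ}
    (T : HolomorphicChain 𝓘(ℂ, V) Ω (q + 1)) {b : V} {r s : ℝ} (hr : 0 < r) (hs0 : 0 < s)
    (hs1 : s ≤ 1) (hball : Metric.ball b (r / s) ⊆ (Ω : Set V))
    (hfin : (μHE[2 * q + 1 + 1] : Measure V)
      ((fun y : V => b + r • y) ⁻¹' T.carrier ∩ Metric.ball (0 : V) 1) ≠ (⊤ : ℝ≥0∞))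
    (hint : letI : InnerProductSpace ℝ V := InnerProductSpace.complexToReal
      Integrable (fun y => ((T.density (b + r • y) : ℤ) : ℝ) •
        frameVector (T.orientationFrame (b + r • y)))
        ((μHE[2 * q + 1 + 1] : Measure V).restrict
          ((fun y : V => b + r • y) ⁻¹' T.carrier ∩ Metric.ball (0 : V) 1)))
    {z : V → V}
    (hz : ∀ᵐ y ∂((μHE[2 * q + 1 + 1] : Measure V).restrict
        ((fun y : V => b + r • y) ⁻¹' T.carrier ∩ Metric.ball (0 : V) 1)),
      z y ∈ Submodule.span ℝ (Set.range (T.orientationFrame (b + r • y))))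
    (hθz : Integrable (fun y => |((T.density (b + r • y) : ℤ) : ℝ)| * ‖y - z y‖)
      ((μHE[2 * q + 1 + 1] : Measure V).restrict
        ((fun y : V => b + r • y) ⁻¹' T.carrier ∩ Metric.ball (0 : V) 1)))
    (ψ : TestForm (unitBall V) (2 * q + 1 + 1)) (hψs : tsupport ⇑ψ ⊆ Metric.ball (0 : V) s)
    {M : ℝ} (hM : ∀ x, ‖extDeriv ⇑ψ x‖ ≤ M) :
    |(T.blowUp b r : Current (unitBall V) (2 * q + 1 + 1)) ψ -
        (T.blowUp b (r / s) : Current (unitBall V) (2 * q + 1 + 1)) ψ| ≤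
      (1 - s) * M * ∫ y in (fun y : V => b + r • y) ⁻¹' T.carrier ∩ Metric.ball (0 : V) 1,
        |((T.density (b + r • y) : ℤ) : ℝ)| * ‖y - z y‖ ∂(μHE[2 * q + 1 + 1] : Measure V) :=
  T.abs_blowUp_sub_apply_le (h V Ω (q + 1) T) (h' V Ω q T) hr hs0 hs1 hball hfin hint hz hθz ψ
    hψs hM

/-- **Telescoped flat estimate along the geometric scales `r sᵏ`.** Under the hypotheses of
`HolomorphicChain.abs_blowUp_sub_apply_le` at every scale `r sᵏ` (`k < n`; admissible data, cycle,
finite mass of each `D_{r sᵏ⁺¹}`, tangent choices `z k`), for a test form `ψ` supported in `B(0,s)`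
with `‖dψ‖ ≤ M`:
`|D_{r sⁿ}(ψ) − D_r(ψ)| ≤ (1 − s) · M · Σ_{k<n} ∫_{W_{r sᵏ⁺¹}} |θ| ‖y − z_k(y)‖ d𝓗^{2q+2}` —
so SUMMABILITY of the conical defects of the blow-ups along the scales `r sᵏ` (the finiteness
statement behind King's theorem) makes `(D_{r sᵏ}(ψ))_k` Cauchy, uniformly for `‖dψ‖ ≤ 1`.
[cite: Federer1969, 4.3.16] -/
theorem HolomorphicChain.abs_blowUp_pow_sub_apply_le [FiniteDimensional ℂ V] {q : ℕ}
    (T : HolomorphicChain 𝓘(ℂ, V) Ω (q + 1))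
    (hT : letI : InnerProductSpace ℝ V := InnerProductSpace.complexToReal
      IsRectifiableData Ω (2 * (q + 1)) T.carrier T.density T.orientationFrame)
    (h0 : T.boundary = 0) {b : V} {r s : ℝ} (hr : 0 < r) (hs0 : 0 < s) (hs1 : s ≤ 1)
    (hball : Metric.ball b r ⊆ (Ω : Set V))
    (hfin : ∀ k : ℕ, (μHE[2 * q + 1 + 1] : Measure V)
      ((fun y : V => b + (r * s ^ (k + 1)) • y) ⁻¹' T.carrier ∩ Metric.ball (0 : V) 1) ≠ (⊤ : ℝ≥0∞))
    (hint : ∀ k : ℕ, letI : InnerProductSpace ℝ V := InnerProductSpace.complexToReal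
      Integrable (fun y => ((T.density (b + (r * s ^ (k + 1)) • y) : ℤ) : ℝ) •
        frameVector (T.orientationFrame (b + (r * s ^ (k + 1)) • y)))
        ((μHE[2 * q + 1 + 1] : Measure V).restrict
          ((fun y : V => b + (r * s ^ (k + 1)) • y) ⁻¹' T.carrier ∩ Metric.ball (0 : V) 1)))
    (z : ℕ → V → V)
    (hz : ∀ k : ℕ, ∀ᵐ y ∂((μHE[2 * q + 1 + 1] : Measure V).restrict
        ((fun y : V => b + (r * s ^ (k + 1)) • y) ⁻¹' T.carrier ∩ Metric.ball (0 : V) 1)),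
      z k y ∈ Submodule.span ℝ (Set.range (T.orientationFrame (b + (r * s ^ (k + 1)) • y))))
    (hθz : ∀ k : ℕ, Integrable (fun y => |((T.density (b + (r * s ^ (k + 1)) • y) : ℤ) : ℝ)| * ‖y - z k y‖)
      ((μHE[2 * q + 1 + 1] : Measure V).restrict
        ((fun y : V => b + (r * s ^ (k + 1)) • y) ⁻¹' T.carrier ∩ Metric.ball (0 : V) 1)))
    (ψ : TestForm (unitBall V) (2 * q + 1 + 1)) (hψs : tsupport ⇑ψ ⊆ Metric.ball (0 : V) s)
    {M : ℝ} (hM : ∀ x, ‖extDeriv ⇑ψ x‖ ≤ M) (n : ℕ) :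
    |(T.blowUp b (r * s ^ n) : Current (unitBall V) (2 * q + 1 + 1)) ψ -
        (T.blowUp b r : Current (unitBall V) (2 * q + 1 + 1)) ψ| ≤
      (1 - s) * M * ∑ k ∈ Finset.range n,
        ∫ y in (fun y : V => b + (r * s ^ (k + 1)) • y) ⁻¹' T.carrier ∩ Metric.ball (0 : V) 1,
          |((T.density (b + (r * s ^ (k + 1)) • y) : ℤ) : ℝ)| * ‖y - z k y‖
            ∂(μHE[2 * q + 1 + 1] : Measure V) := by
  induction n with
  | zero => simp
  | succ n ih =>
    -- one more step: `D_{r s^{n+1}}` against `D_{r s^{n+1} / s} = D_{r sⁿ}`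
    have hrk : 0 < r * s ^ (n + 1) := mul_pos hr (pow_pos hs0 _)
    have hdiv : r * s ^ (n + 1) / s = r * s ^ n := by
      rw [pow_succ, ← mul_assoc, mul_div_assoc, div_self hs0.ne', mul_one]
    have hballk : Metric.ball b (r * s ^ (n + 1) / s) ⊆ (Ω : Set V) := by
      rw [hdiv]
      refine (Metric.ball_subset_ball ?_).trans hball
      exact mul_le_of_le_one_right hr.le (pow_le_one₀ hs0.le hs1)
    have hstep := T.abs_blowUp_sub_apply_le hT h0 hrk hs0 hs1 hballk (hfin n) (hint n) (hz n)
      (hθz n) ψ hψs hM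
    rw [hdiv] at hstep
    rw [Finset.sum_range_succ, mul_add ((1 - s) * M)]
    calc |(T.blowUp b (r * s ^ (n + 1)) : Current (unitBall V) (2 * q + 1 + 1)) ψ -
          (T.blowUp b r : Current (unitBall V) (2 * q + 1 + 1)) ψ|
        ≤ |(T.blowUp b (r * s ^ (n + 1)) : Current (unitBall V) (2 * q + 1 + 1)) ψ -
            (T.blowUp b (r * s ^ n) : Current (unitBall V) (2 * q + 1 + 1)) ψ| +
          |(T.blowUp b (r * s ^ n) : Current (unitBall V) (2 * q + 1 + 1)) ψ -
            (T.blowUp b r : Current (unitBall V) (2 * q + 1 + 1)) ψ| := abs_sub_le _ _ _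
      _ ≤ _ := by linarith [hstep, ih]

end Literature.Geometry.Kaehler
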